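import Literature.Geometry.Riemannian.PositiveCurvatureOperatorBlocks
import Literature.Geometry.Riemannian.SelfDualMetricFrameProofs
import Literature.Geometry.Riemannian.NeumannIsotropicFormPos
import Literature.Geometry.Riemannian.HamiltonNCOClassification
import Literature.Geometry.Riemannian.AlmostNonnegativeCurvatureSmoothingProofs
import HarnessLib

/-!
# `Rm(φ, φ) = M(v, v)`: the curvature operator form of every 2-vector is Hamilton's block
quadratic form (topic `Geometry/Riemannian`)

A brick of the printed proofs of the named facts
`Literature.Geometry.Riemannian.hamilton_nonnegCurvatureOperator_classification_four` (Hamilton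
1986, **Thm. 1.3**) and `hamilton_positiveCurvatureOperator_classification_four` (**Thm. 1.1**)
(`HamiltonNCOClassification.lean`, `HamiltonPCOClassification.lean`; R. S. Hamilton,
*Four-manifolds with positive curvature operator*, J. Differential Geom. 24 (1986)). Both
theorems are HYPOTHESISED in the 2-vector language of p. 153 ("`Rm(φ, φ) > 0` for all two-forms
`φ ≠ 0`", "`Rm(φ, φ) ≥ 0` for all `φ`": `HasPositiveCurvatureOperatorWith`,
`HasNonnegCurvatureOperatorWith`, on lists of pairs `φ = Σₐ Xₐ ∧ Yₐ`, `curvatureOperatorForm`) and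
PROVED in the block language of §6 (the matrix `M = (A B; ᵗB C)` of the curvature operator on
`Λ² = Λ²₊ ⊕ Λ²₋` in an orthonormal frame; the tree's `blockA/B/C` and `HamiltonODE.quad`), and the
conclusions of §§8–9 come back in block language (§9, case 6, p. 179: "Here `M_{αβ} > 0` so the
manifold is `S⁴` or `RP⁴` by our previous result", i.e. Thm. 1.1 is applied to a metric whose
BLOCKS are positive). `PositiveCurvatureOperatorBlocks.lean` proves one direction of the
dictionary, `quad_blocks_eq_curvatureOperatorForm`: `M(v, v) = Rm(Φ_v, Φ_v)` for ONE particular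
2-vector `Φ_v = Σ xₛ φₛ + Σ yₛ ψₛ`. This file proves the converse and the resulting equivalences
(theorems only; no definitions, no named facts):

* `sum_mul_mul_eq_quarter_antisymm`, `sum_comm_two_four` — finite-sum algebra
  (antisymmetrisation over two skew pairs of slots).
* `curvatureOperatorForm_eq_sum_frame`, `curvatureOperatorForm_eq_sum_bivectorForm` — in a
  `g_x`-orthonormal frame `e` of a four-dimensional tangent space,
  `Rm(φ, φ) = -¼ Σ_{ijkl} φ♭(eᵢ,eⱼ) φ♭(e_k,e_l) Rm(eᵢ,eⱼ,e_k,e_l)` (`φ♭ = bivectorForm`, the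
  alternating form of the 2-vector; expansion `IsOrthonormalFrame.eq_sum_smul`, multilinearity
  `curvatureForm_sum_smul`, and the skew-symmetries of `Rm` in its first and last pair, O'Neill
  1983, Prop. 3.36 (1)–(2), `curvatureForm_antisymm`, `IsLeviCivita.val_curvature_skew`); hence
  `curvatureOperatorForm_eq_of_bivectorForm_frame_eq`: **`Rm(φ, φ)` depends only on the 2-vector
  `φ♭`, not on the list of pairs representing it**.
* `curvatureOperatorForm_eq_quad_blocks` — **`Rm(φ, φ) = M(v, v)` for EVERY `φ`**, at the
  `Λ²₊ ⊕ Λ²₋`-coordinates `v = (x, y)` of `φ`, `xₛ = ½(φ♭(e₀,e_{s+1}) + φ♭(e_p,e_q))`,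
  `yₛ = ½(φ♭(e₀,e_{s+1}) - φ♭(e_p,e_q))`, `(p,q) = (2,3),(3,1),(1,2)` (the frame coefficients of
  `Φ_v`, `bivectorForm_blockComb_zero_succ/compl`, and `skew_four_ext`);
  `bivectorForm_eq_sum_frame`, `blockCoords_ne_zero` — `φ♭ ≠ 0` iff `v ≠ 0`.
* `hasNonnegCurvatureOperatorWith_iff_operatorGE_blocks`,
  `hasPositiveCurvatureOperatorWith_iff_quad_blocks_pos` (and the `_of_` directions) — **`Rm ≥ 0`
  iff `M ≥ 0`, `Rm > 0` iff `M > 0`, in every orthonormal frame** (four-dimensional Riemannian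
  manifold, Levi-Civita connection of a `C^n` metric, `n ≥ 2`; orthonormal frames exist,
  `exists_isOrthonormalFrame_four`);
  `hasNonnegCurvatureOperator_iff_operatorGE_blocks`, `hasPositiveCurvatureOperator_iff_quad_blocks_pos`
  — the metric-level notions (all Levi-Civita connections, which share `Rm(φ, φ)`,
  `IsLeviCivita.curvatureOperatorForm_eq_of_isLeviCivita`) tested on the blocks of one connection.

## References

* R. S. Hamilton, *Four-manifolds with positive curvature operator*, J. Differential Geom. 24
  (1986) 153–179: §1, p. 153 (the definitions); §6, p. 165 (`M = (A B; ᵗB C)`); §7, p. 170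
  ("if `M > 0` …"); §8, Lemma 8.2 (p. 174); §9, case 6 (p. 179). [Hamilton1986]
* R. S. Hamilton, Comm. Anal. Geom. 5 (1997), §1.2, pp. 4–5 (the bases `φᵢ`, `ψᵢ`). [Hamilton1997]
* B. O'Neill, *Semi-Riemannian geometry*, Academic Press 1983, Ch. 3, Prop. 3.36. [ONeill1983]
-/

noncomputable section

open Bundle Set Function Matrix Finset Module
open scoped Manifold ContDiff Topology BigOperators

namespace Literature.Geometry.Riemannian

open Lorentzian Lorentzian.PseudoRiemannianMetric HamiltonODE

section Frame

variable {E : Type*} [NormedAddCommGroup E] [NormedSpace ℝ E] {H : Type*} [TopologicalSpace H]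
  {I : ModelWithCorners ℝ E H} {M : Type*} [TopologicalSpace M] [ChartedSpace H M]
  [IsManifold I ∞ M] {n : ℕ∞ω}
  {g : PseudoRiemannianMetric I n E (TangentSpace I : M → Type _)}
  {cov : CovariantDerivative I E (TangentSpace I : M → Type _)}

/-! ### Antisymmetrisation over a pair of skew slots -/

/-- **Antisymmetrisation**: for an array `R_{ijkl}` skew in `(i, j)` and in `(k, l)` and any
coefficient array `P`, `Σ P_{ij} P_{lk} R_{ijkl} = ¼ Σ (P_{ij} - P_{ji})(P_{lk} - P_{kl}) R_{ijkl}`.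
[folklore] -/
theorem sum_mul_mul_eq_quarter_antisymm {ι : Type*} [Fintype ι] (R : ι → ι → ι → ι → ℝ)
    (h12 : ∀ i j k l, R j i k l = -R i j k l) (h34 : ∀ i j k l, R i j l k = -R i j k l)
    (P : ι → ι → ℝ) :
    ∑ i, ∑ j, ∑ k, ∑ l, P i j * P l k * R i j k l =
      (1 / 4 : ℝ) * ∑ i, ∑ j, ∑ k, ∑ l, (P i j - P j i) * (P l k - P k l) * R i j k l := by
  set S := ∑ i, ∑ j, ∑ k, ∑ l, P i j * P l k * R i j k l with hS
  -- the three companions of `S`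
  have S2 : ∑ i, ∑ j, ∑ k, ∑ l, P i j * P k l * R i j k l = -S := by
    rw [hS, ← sum_neg_distrib]
    refine sum_congr rfl fun i _ ↦ ?_
    rw [← sum_neg_distrib]
    refine sum_congr rfl fun j _ ↦ ?_
    rw [sum_comm, ← sum_neg_distrib]
    refine sum_congr rfl fun k _ ↦ ?_
    rw [← sum_neg_distrib]
    refine sum_congr rfl fun l _ ↦ ?_
    rw [h34]; ring
  have S3 : ∑ i, ∑ j, ∑ k, ∑ l, P j i * P l k * R i j k l = -S := by
    rw [hS, sum_comm, ← sum_neg_distrib]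
    refine sum_congr rfl fun i _ ↦ ?_
    rw [← sum_neg_distrib]
    refine sum_congr rfl fun j _ ↦ ?_
    rw [← sum_neg_distrib]
    refine sum_congr rfl fun k _ ↦ ?_
    rw [← sum_neg_distrib]
    refine sum_congr rfl fun l _ ↦ ?_
    rw [h12]; ring
  have S4 : ∑ i, ∑ j, ∑ k, ∑ l, P j i * P k l * R i j k l = S := by
    rw [hS, sum_comm]
    refine sum_congr rfl fun i _ ↦ sum_congr rfl fun j _ ↦ ?_
    rw [sum_comm]
    refine sum_congr rfl fun k _ ↦ sum_congr rfl fun l _ ↦ ?_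
    rw [h12, h34]; ring
  -- expand the right-hand side
  have hexp : ∑ i, ∑ j, ∑ k, ∑ l, (P i j - P j i) * (P l k - P k l) * R i j k l =
      (∑ i, ∑ j, ∑ k, ∑ l, P i j * P l k * R i j k l) -
        (∑ i, ∑ j, ∑ k, ∑ l, P i j * P k l * R i j k l) -
        (∑ i, ∑ j, ∑ k, ∑ l, P j i * P l k * R i j k l) +
        ∑ i, ∑ j, ∑ k, ∑ l, P j i * P k l * R i j k l := by
    simp only [← sum_sub_distrib, ← sum_add_distrib]
    refine sum_congr rfl fun i _ ↦ sum_congr rfl fun j _ ↦ sum_congr rfl fun k _ ↦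
      sum_congr rfl fun l _ ↦ ?_
    ring
  rw [hexp, ← hS, S2, S3, S4]
  ring

/-! ### The curvature operator form through the frame coefficients of the 2-vector -/

/-- Commuting a block of two sums past a block of four. [folklore] -/
theorem sum_comm_two_four {α β : Type*} [Fintype α] [Fintype β]
    (f : α → α → β → β → β → β → ℝ) :
    ∑ a, ∑ b, ∑ i, ∑ j, ∑ k, ∑ l, f a b i j k l =
      ∑ i, ∑ j, ∑ k, ∑ l, ∑ a, ∑ b, f a b i j k l := by
  calc ∑ a, ∑ b, ∑ i, ∑ j, ∑ k, ∑ l, f a b i j k l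
      = ∑ a, ∑ i, ∑ j, ∑ k, ∑ l, ∑ b, f a b i j k l := by
        refine sum_congr rfl fun a _ ↦ ?_
        rw [sum_comm]
        refine sum_congr rfl fun i _ ↦ ?_
        rw [sum_comm]
        refine sum_congr rfl fun j _ ↦ ?_
        rw [sum_comm]
        refine sum_congr rfl fun k _ ↦ ?_
        rw [sum_comm]
    _ = ∑ i, ∑ j, ∑ k, ∑ l, ∑ a, ∑ b, f a b i j k l := by
        rw [sum_comm]
        refine sum_congr rfl fun i _ ↦ ?_
        rw [sum_comm]
        refine sum_congr rfl fun j _ ↦ ?_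
        rw [sum_comm]
        refine sum_congr rfl fun k _ ↦ ?_
        rw [sum_comm]

variable [FiniteDimensional ℝ E]

/-- **Frame expansion of `Rm(φ, φ)`**: in a `g_x`-orthonormal frame `e` of a four-dimensional
tangent space, `Rm(φ, φ) = Σ_{ijkl} P_{ij} P_{lk} Rm(eᵢ, eⱼ, e_k, e_l)` for `φ = Σₐ Xₐ ∧ Yₐ`,
where `P_{ij} = Σₐ g(Xₐ, eᵢ) g(Yₐ, eⱼ)`. [folklore] -/
theorem curvatureOperatorForm_eq_sum_frame (hE : finrank ℝ E = 4) (x : M)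
    {e : Fin 4 → TangentSpace I x} (he : g.IsOrthonormalFrame x e) {m : ℕ}
    (X Y : Fin m → TangentSpace I x) :
    g.curvatureOperatorForm cov x X Y =
      ∑ i, ∑ j, ∑ k, ∑ l,
        (∑ a, g.val x (X a) (e i) * g.val x (Y a) (e j)) *
          (∑ b, g.val x (X b) (e l) * g.val x (Y b) (e k)) *
            g.curvatureForm cov x (e i) (e j) (e k) (e l) := by
  have key : ∀ a b, g.curvatureForm cov x (X a) (Y a) (Y b) (X b) =
      ∑ i, ∑ j, ∑ k, ∑ l, g.val x (X a) (e i) * g.val x (Y a) (e j) * g.val x (Y b) (e k) *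
        g.val x (X b) (e l) * g.curvatureForm cov x (e i) (e j) (e k) (e l) := by
    intro a b
    conv_lhs => rw [he.eq_sum_smul hE (X a), he.eq_sum_smul hE (Y a), he.eq_sum_smul hE (Y b),
      he.eq_sum_smul hE (X b)]
    exact curvatureForm_sum_smul x e _ _ _ _
  have hR : ∀ i j k l,
      (∑ a, g.val x (X a) (e i) * g.val x (Y a) (e j)) *
          (∑ b, g.val x (X b) (e l) * g.val x (Y b) (e k)) *
            g.curvatureForm cov x (e i) (e j) (e k) (e l) =
        ∑ a, ∑ b, g.val x (X a) (e i) * g.val x (Y a) (e j) * g.val x (Y b) (e k) *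
          g.val x (X b) (e l) * g.curvatureForm cov x (e i) (e j) (e k) (e l) := by
    intro i j k l
    rw [sum_mul_sum, sum_mul]
    refine sum_congr rfl fun a _ ↦ ?_
    rw [sum_mul]
    refine sum_congr rfl fun b _ ↦ ?_
    ring
  simp only [curvatureOperatorForm, key, hR]
  exact sum_comm_two_four _

/-- **`Rm(φ, φ)` depends only on the frame coefficients `φ♭(eᵢ, eⱼ)` of the 2-vector**: for a
Levi-Civita connection of a `C^n` metric (`n ≥ 2`) and a `g_x`-orthonormal frame `e` of a
four-dimensional tangent space,
`Rm(φ, φ) = -¼ Σ_{ijkl} φ♭(eᵢ, eⱼ) φ♭(e_k, e_l) Rm(eᵢ, eⱼ, e_k, e_l)`, where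
`φ♭ = g.bivectorForm x X Y` is the alternating form of `φ = Σₐ Xₐ ∧ Yₐ` (`CurvatureOperator.lean`)
— by the skew-symmetry of `Rm` in its first and in its last pair (O'Neill 1983, Prop. 3.36
(1)–(2)). [folklore] -/
theorem curvatureOperatorForm_eq_sum_bivectorForm (hE : finrank ℝ E = 4) (hLC : g.IsLeviCivita cov)
    (hn : 2 ≤ n) (x : M) {e : Fin 4 → TangentSpace I x} (he : g.IsOrthonormalFrame x e) {m : ℕ}
    (X Y : Fin m → TangentSpace I x) :
    g.curvatureOperatorForm cov x X Y =
      -(1 / 4 : ℝ) * ∑ i, ∑ j, ∑ k, ∑ l,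
        g.bivectorForm x X Y (e i) (e j) * g.bivectorForm x X Y (e k) (e l) *
          g.curvatureForm cov x (e i) (e j) (e k) (e l) := by
  haveI : CompleteSpace E := FiniteDimensional.complete ℝ E
  rw [curvatureOperatorForm_eq_sum_frame hE x he X Y,
    sum_mul_mul_eq_quarter_antisymm (fun i j k l ↦ g.curvatureForm cov x (e i) (e j) (e k) (e l))
      (fun i j k l ↦ by rw [curvatureForm_antisymm])
      (fun i j k l ↦ by
        simp only [curvatureForm]
        rw [hLC.val_curvature_skew hn])
      (fun i j ↦ ∑ a, g.val x (X a) (e i) * g.val x (Y a) (e j))]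
  rw [neg_mul, ← mul_neg, ← sum_neg_distrib]
  congr 1
  refine sum_congr rfl fun i _ ↦ ?_
  rw [← sum_neg_distrib]
  refine sum_congr rfl fun j _ ↦ ?_
  rw [← sum_neg_distrib]
  refine sum_congr rfl fun k _ ↦ ?_
  rw [← sum_neg_distrib]
  refine sum_congr rfl fun l _ ↦ ?_
  have hc : ∀ p q, g.bivectorForm x X Y (e p) (e q) =
      ∑ a, g.val x (X a) (e p) * g.val x (Y a) (e q) -
        ∑ a, g.val x (X a) (e q) * g.val x (Y a) (e p) := by
    intro p q
    simp only [bivectorForm, ← sum_sub_distrib]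
    refine sum_congr rfl fun a _ ↦ ?_
    ring
  rw [hc i j, hc k l]
  ring

/-- Consequently **two lists of pairs with the same frame coefficients have the same
`Rm(φ, φ)`** (they define the same 2-vector). [folklore] -/
theorem curvatureOperatorForm_eq_of_bivectorForm_frame_eq (hE : finrank ℝ E = 4)
    (hLC : g.IsLeviCivita cov) (hn : 2 ≤ n) (x : M) {e : Fin 4 → TangentSpace I x}
    (he : g.IsOrthonormalFrame x e) {m m' : ℕ} (X Y : Fin m → TangentSpace I x)
    (X' Y' : Fin m' → TangentSpace I x)
    (h : ∀ i j, g.bivectorForm x X Y (e i) (e j) = g.bivectorForm x X' Y' (e i) (e j)) :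
    g.curvatureOperatorForm cov x X Y = g.curvatureOperatorForm cov x X' Y' := by
  rw [curvatureOperatorForm_eq_sum_bivectorForm hE hLC hn x he X Y,
    curvatureOperatorForm_eq_sum_bivectorForm hE hLC hn x he X' Y']
  simp only [h]

/-! ### A skew frame array is determined by six entries -/

omit [FiniteDimensional ℝ E] in
/-- Two skew `4 × 4` arrays agreeing on the entries `(0,1), (0,2), (0,3)` and `(2,3), (3,1), (1,2)`
agree everywhere. [folklore] -/
theorem skew_four_ext {c c' : Fin 4 → Fin 4 → ℝ} (hc : ∀ i j, c i j = -c j i)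
    (hc' : ∀ i j, c' i j = -c' j i) (h0 : ∀ s : Fin 3, c 0 s.succ = c' 0 s.succ)
    (h1 : ∀ s : Fin 3, c ((![2, 3, 1] : Fin 3 → Fin 4) s) ((![3, 1, 2] : Fin 3 → Fin 4) s) =
      c' ((![2, 3, 1] : Fin 3 → Fin 4) s) ((![3, 1, 2] : Fin 3 → Fin 4) s)) :
    ∀ i j, c i j = c' i j := by
  have d : ∀ i, c i i = 0 := fun i ↦ by have := hc i i; linarith
  have d' : ∀ i, c' i i = 0 := fun i ↦ by have := hc' i i; linarith
  have e01 := h0 0; have e02 := h0 1; have e03 := h0 2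
  have e23 := h1 0; have e31 := h1 1; have e12 := h1 2
  simp only [Fin.isValue, Fin.succ_zero_eq_one, Fin.succ_one_eq_two, Matrix.cons_val_zero,
    Matrix.cons_val_one, Matrix.cons_val] at e01 e02 e03 e23 e31 e12
  intro i j
  fin_cases i <;> fin_cases j
  · simp [d, d']
  · simpa using e01
  · simpa using e02
  · simpa using e03
  · rw [hc, hc']; simpa using e01
  · simp [d, d']
  · simpa using e12
  · rw [hc, hc']; simpa using e31
  · rw [hc, hc']; simpa using e02
  · rw [hc, hc']; simpa using e12
  · simp [d, d']
  · simpa using e23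
  · rw [hc, hc']; simpa using e03
  · simpa using e31
  · rw [hc, hc']; simpa using e23
  · simp [d, d']

/-! ### The block quadratic form computes `Rm(φ, φ)` for every 2-vector -/

omit [FiniteDimensional ℝ E] in
/-- The frame coefficients of Hamilton's 2-vector `Φ_v = Σ xₛ φₛ + Σ yₛ ψₛ` on the pairs
`(X₁, X_{s+1})`: `xₛ + yₛ`. [cite: Hamilton1997, §1.2, p. 5] -/
theorem bivectorForm_blockComb_zero_succ (x : M) {e : Fin 4 → TangentSpace I x}
    (he : g.IsOrthonormalFrame x e) (v : (Fin 3 → ℝ) × (Fin 3 → ℝ)) (s : Fin 3) :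
    g.bivectorForm x (Fin.append (selfDualCombFst e v.1) (antiSelfDualCombFst e v.2))
      (Fin.append (selfDualCombSnd e) (antiSelfDualCombSnd e)) (e 0) (e s.succ) = v.1 s + v.2 s := by
  rw [bivectorForm_append, bivectorForm_selfDualComb x he, bivectorForm_antiSelfDualComb x he]

omit [FiniteDimensional ℝ E] in
/-- The frame coefficients of `Φ_v` on the complementary pairs `(X₃, X₄)`, `(X₄, X₂)`, `(X₂, X₃)`:
`xₛ - yₛ`. [cite: Hamilton1997, §1.2, p. 5] -/
theorem bivectorForm_blockComb_compl (x : M) {e : Fin 4 → TangentSpace I x}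
    (he : g.IsOrthonormalFrame x e) (v : (Fin 3 → ℝ) × (Fin 3 → ℝ)) (s : Fin 3) :
    g.bivectorForm x (Fin.append (selfDualCombFst e v.1) (antiSelfDualCombFst e v.2))
      (Fin.append (selfDualCombSnd e) (antiSelfDualCombSnd e))
        (e ((![2, 3, 1] : Fin 3 → Fin 4) s)) (e ((![3, 1, 2] : Fin 3 → Fin 4) s)) = v.1 s - v.2 s := by
  rw [bivectorForm_append, bivectorForm_selfDualComb_compl x he,
    bivectorForm_antiSelfDualComb_compl x he]
  ring

/-- **`Rm(φ, φ) = M(v, v)`: the curvature operator form of ANY 2-vector `φ = Σₐ Xₐ ∧ Yₐ` is the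
block quadratic form `ᵗx A x + 2 ᵗx B y + ᵗy C y` (`HamiltonODE.quad`) of Hamilton's blocks in a
`g_x`-orthonormal frame `e`, at the `Λ²₊ ⊕ Λ²₋`-coordinates `v = (x, y)` of `φ`**,
`xₛ = ½(φ♭(e₀, e_{s+1}) + φ♭(e_p, e_q))`, `yₛ = ½(φ♭(e₀, e_{s+1}) - φ♭(e_p, e_q))` with
`(p, q) = (2,3), (3,1), (1,2)` — for a Levi-Civita connection of a `C^n` metric, `n ≥ 2`, on a
four-dimensional tangent space. (The converse direction of `quad_blocks_eq_curvatureOperatorForm`,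
which computes `M(v, v)` as the `Rm(Φ_v, Φ_v)` of one particular 2-vector.) Hamilton 1986, p. 153
and §6: the curvature operator `Rm(φ, φ)` on `Λ²` IS the matrix `M = (A B; ᵗB C)`.
[cite: Hamilton1986, §1, p. 153; §6, p. 165] -/
theorem curvatureOperatorForm_eq_quad_blocks (hE : finrank ℝ E = 4) (hLC : g.IsLeviCivita cov)
    (hn : 2 ≤ n) (x : M) {e : Fin 4 → TangentSpace I x} (he : g.IsOrthonormalFrame x e) {m : ℕ}
    (X Y : Fin m → TangentSpace I x) :
    g.curvatureOperatorForm cov x X Y =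
      quad (g.blockA cov x e, g.blockB cov x e, g.blockC cov x e)
        (fun s ↦ (g.bivectorForm x X Y (e 0) (e s.succ) +
            g.bivectorForm x X Y (e ((![2, 3, 1] : Fin 3 → Fin 4) s))
              (e ((![3, 1, 2] : Fin 3 → Fin 4) s))) / 2,
          fun s ↦ (g.bivectorForm x X Y (e 0) (e s.succ) -
            g.bivectorForm x X Y (e ((![2, 3, 1] : Fin 3 → Fin 4) s))
              (e ((![3, 1, 2] : Fin 3 → Fin 4) s))) / 2) := by
  haveI : CompleteSpace E := FiniteDimensional.complete ℝ E
  rw [quad_blocks_eq_curvatureOperatorForm hLC hn]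
  refine curvatureOperatorForm_eq_of_bivectorForm_frame_eq hE hLC hn x he X Y _ _ ?_
  refine skew_four_ext (fun i j ↦ g.bivectorForm_swap x X Y (e i) (e j))
    (fun i j ↦ g.bivectorForm_swap x _ _ (e i) (e j)) (fun s ↦ ?_) (fun s ↦ ?_)
  · rw [bivectorForm_blockComb_zero_succ x he]
    ring
  · rw [bivectorForm_blockComb_compl x he]
    ring

/-- The alternating form `φ♭(a, b)` expands over the frame:
`φ♭(a, b) = Σᵢⱼ g(a, eᵢ) g(b, eⱼ) φ♭(eᵢ, eⱼ)`. [folklore] -/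
theorem bivectorForm_eq_sum_frame (hE : finrank ℝ E = 4) (x : M) {e : Fin 4 → TangentSpace I x}
    (he : g.IsOrthonormalFrame x e) {m : ℕ} (X Y : Fin m → TangentSpace I x)
    (a b : TangentSpace I x) :
    g.bivectorForm x X Y a b =
      ∑ i, ∑ j, g.val x a (e i) * g.val x b (e j) * g.bivectorForm x X Y (e i) (e j) := by
  have ha := he.eq_sum_smul hE a
  have hb := he.eq_sum_smul hE b
  have key : ∀ (Z : TangentSpace I x), g.val x Z a = ∑ i, g.val x a (e i) * g.val x Z (e i) := by
    intro Z
    conv_lhs => rw [ha]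
    simp only [map_sum, map_smul, smul_eq_mul]
  have key' : ∀ (Z : TangentSpace I x), g.val x Z b = ∑ j, g.val x b (e j) * g.val x Z (e j) := by
    intro Z
    conv_lhs => rw [hb]
    simp only [map_sum, map_smul, smul_eq_mul]
  symm
  calc ∑ i, ∑ j, g.val x a (e i) * g.val x b (e j) * g.bivectorForm x X Y (e i) (e j)
      = ∑ i, ∑ j, ∑ c, g.val x a (e i) * g.val x b (e j) *
          (g.val x (X c) (e i) * g.val x (Y c) (e j) - g.val x (Y c) (e i) * g.val x (X c) (e j)) := by
        simp only [bivectorForm, mul_sum]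
    _ = ∑ i, ∑ c, ∑ j, g.val x a (e i) * g.val x b (e j) *
          (g.val x (X c) (e i) * g.val x (Y c) (e j) - g.val x (Y c) (e i) * g.val x (X c) (e j)) :=
        sum_congr rfl fun i _ ↦ sum_comm
    _ = ∑ c, ∑ i, ∑ j, g.val x a (e i) * g.val x b (e j) *
          (g.val x (X c) (e i) * g.val x (Y c) (e j) - g.val x (Y c) (e i) * g.val x (X c) (e j)) :=
        sum_comm
    _ = ∑ c, ((∑ i, g.val x a (e i) * g.val x (X c) (e i)) * (∑ j, g.val x b (e j) * g.val x (Y c) (e j)) -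
          (∑ i, g.val x a (e i) * g.val x (Y c) (e i)) * (∑ j, g.val x b (e j) * g.val x (X c) (e j))) := by
        refine sum_congr rfl fun c _ ↦ ?_
        rw [sum_mul_sum, sum_mul_sum, ← sum_sub_distrib]
        refine sum_congr rfl fun i _ ↦ ?_
        rw [← sum_sub_distrib]
        refine sum_congr rfl fun j _ ↦ ?_
        ring
    _ = g.bivectorForm x X Y a b := by
        simp only [bivectorForm, key, key']

/-- If all frame coefficients `φ♭(eᵢ, eⱼ)` vanish then `φ♭ = 0`. [folklore] -/
theorem bivectorForm_eq_zero_of_frame (hE : finrank ℝ E = 4) (x : M) {e : Fin 4 → TangentSpace I x}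
    (he : g.IsOrthonormalFrame x e) {m : ℕ} (X Y : Fin m → TangentSpace I x)
    (h : ∀ i j, g.bivectorForm x X Y (e i) (e j) = 0) (a b : TangentSpace I x) :
    g.bivectorForm x X Y a b = 0 := by
  rw [bivectorForm_eq_sum_frame hE x he X Y a b]
  exact sum_eq_zero fun i _ ↦ sum_eq_zero fun j _ ↦ by rw [h i j, mul_zero]

/-- **A 2-vector with `φ♭ ≠ 0` has non-zero `Λ²₊ ⊕ Λ²₋`-coordinates** in an orthonormal frame.
[folklore] -/
theorem blockCoords_ne_zero (hE : finrank ℝ E = 4) (x : M) {e : Fin 4 → TangentSpace I x}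
    (he : g.IsOrthonormalFrame x e) {m : ℕ} (X Y : Fin m → TangentSpace I x)
    (hXY : ∃ a b : TangentSpace I x, g.bivectorForm x X Y a b ≠ 0) :
    ((fun s ↦ (g.bivectorForm x X Y (e 0) (e s.succ) +
        g.bivectorForm x X Y (e ((![2, 3, 1] : Fin 3 → Fin 4) s))
          (e ((![3, 1, 2] : Fin 3 → Fin 4) s))) / 2,
      fun s ↦ (g.bivectorForm x X Y (e 0) (e s.succ) -
        g.bivectorForm x X Y (e ((![2, 3, 1] : Fin 3 → Fin 4) s))
          (e ((![3, 1, 2] : Fin 3 → Fin 4) s))) / 2) : (Fin 3 → ℝ) × (Fin 3 → ℝ)) ≠ 0 := by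
  obtain ⟨a, b, hab⟩ := hXY
  intro h0
  apply hab
  apply bivectorForm_eq_zero_of_frame hE x he X Y
  have h1 : ∀ s : Fin 3, (g.bivectorForm x X Y (e 0) (e s.succ) +
      g.bivectorForm x X Y (e ((![2, 3, 1] : Fin 3 → Fin 4) s))
        (e ((![3, 1, 2] : Fin 3 → Fin 4) s))) / 2 = 0 := fun s ↦ congr_fun (congr_arg Prod.fst h0) s
  have h2 : ∀ s : Fin 3, (g.bivectorForm x X Y (e 0) (e s.succ) -
      g.bivectorForm x X Y (e ((![2, 3, 1] : Fin 3 → Fin 4) s))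
        (e ((![3, 1, 2] : Fin 3 → Fin 4) s))) / 2 = 0 := fun s ↦ congr_fun (congr_arg Prod.snd h0) s
  refine skew_four_ext (c' := fun _ _ ↦ 0) (fun i j ↦ g.bivectorForm_swap x X Y (e i) (e j))
    (fun i j ↦ by simp) (fun s ↦ ?_) (fun s ↦ ?_)
  · have := h1 s; have := h2 s; linarith
  · have := h1 s; have := h2 s; linarith

/-! ### The curvature operator conditions in block form: equivalences -/

/-- **Non-negative curvature operator from the blocks**: on a four-dimensional Riemannian
manifold, if `M = (A B; ᵗB C) ≥ 0` (`HamiltonODE.OperatorGE · 0`) in every orthonormal frame at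
every point, then `Rm(φ, φ) ≥ 0` for every 2-vector (`HasNonnegCurvatureOperatorWith`), for a
Levi-Civita connection of the `C^n` metric, `n ≥ 2`. [cite: Hamilton1986, §1, p. 153; §6, p. 165] -/
theorem hasNonnegCurvatureOperatorWith_of_operatorGE_blocks (hE : finrank ℝ E = 4)
    (hg : g.IsRiemannian) (hLC : g.IsLeviCivita cov) (hn : 2 ≤ n)
    (h : ∀ (x : M) (e : Fin 4 → TangentSpace I x), g.IsOrthonormalFrame x e →
      OperatorGE (g.blockA cov x e, g.blockB cov x e, g.blockC cov x e) 0) :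
    g.HasNonnegCurvatureOperatorWith cov := by
  intro x m X Y
  obtain ⟨e, he⟩ := exists_isOrthonormalFrame_four hg hE.symm.le x
  rw [curvatureOperatorForm_eq_quad_blocks hE hLC hn x he]
  have := h x e he
    (fun s ↦ (g.bivectorForm x X Y (e 0) (e s.succ) +
        g.bivectorForm x X Y (e ((![2, 3, 1] : Fin 3 → Fin 4) s))
          (e ((![3, 1, 2] : Fin 3 → Fin 4) s))) / 2,
      fun s ↦ (g.bivectorForm x X Y (e 0) (e s.succ) -
        g.bivectorForm x X Y (e ((![2, 3, 1] : Fin 3 → Fin 4) s))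
          (e ((![3, 1, 2] : Fin 3 → Fin 4) s))) / 2)
  rwa [zero_mul] at this

/-- **`Rm ≥ 0` iff `M ≥ 0` in every orthonormal frame** (four-dimensional Riemannian manifold,
Levi-Civita connection of a `C^n` metric, `n ≥ 2`): Hamilton's curvature operator `Rm(φ, φ)` on
`Λ²` IS the block matrix `M = (A B; ᵗB C)` (1986, p. 153 and §6).
[cite: Hamilton1986, §1, p. 153; §6, p. 165] -/
theorem hasNonnegCurvatureOperatorWith_iff_operatorGE_blocks (hE : finrank ℝ E = 4)
    (hg : g.IsRiemannian) (hLC : g.IsLeviCivita cov) (hn : 2 ≤ n) :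
    g.HasNonnegCurvatureOperatorWith cov ↔
      ∀ (x : M) (e : Fin 4 → TangentSpace I x), g.IsOrthonormalFrame x e →
        OperatorGE (g.blockA cov x e, g.blockB cov x e, g.blockC cov x e) 0 := by
  haveI : CompleteSpace E := FiniteDimensional.complete ℝ E
  refine ⟨fun hR x e _ v ↦ ?_, hasNonnegCurvatureOperatorWith_of_operatorGE_blocks hE hg hLC hn⟩
  rw [zero_mul, quad_blocks_eq_curvatureOperatorForm hLC hn]
  exact hR x _ _ _

/-- **Positive curvature operator from the blocks**: on a four-dimensional Riemannian manifold,
if `M(v, v) > 0` for `v ≠ 0` in every orthonormal frame at every point (Hamilton's `M > 0`), then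
`Rm(φ, φ) > 0` for every 2-vector `φ ≠ 0` (`HasPositiveCurvatureOperatorWith`), for a Levi-Civita
connection of the `C^n` metric, `n ≥ 2` — the converse of
`HasPositiveCurvatureOperatorWith.quad_blocks_pos`; this is the form in which §9, case 6 of
Hamilton 1986 ("Here `M_{αβ} > 0` so the manifold is `S⁴` or `RP⁴` by our previous result")
feeds Thm. 1.1. [cite: Hamilton1986, §1, p. 153; §9, case 6 (p. 179)] -/
theorem hasPositiveCurvatureOperatorWith_of_quad_blocks_pos (hE : finrank ℝ E = 4)
    (hg : g.IsRiemannian) (hLC : g.IsLeviCivita cov) (hn : 2 ≤ n)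
    (h : ∀ (x : M) (e : Fin 4 → TangentSpace I x), g.IsOrthonormalFrame x e →
      ∀ v : (Fin 3 → ℝ) × (Fin 3 → ℝ), v ≠ 0 →
        0 < quad (g.blockA cov x e, g.blockB cov x e, g.blockC cov x e) v) :
    g.HasPositiveCurvatureOperatorWith cov := by
  intro x m X Y hXY
  obtain ⟨e, he⟩ := exists_isOrthonormalFrame_four hg hE.symm.le x
  rw [curvatureOperatorForm_eq_quad_blocks hE hLC hn x he]
  exact h x e he _ (blockCoords_ne_zero hE x he X Y hXY)

/-- **`Rm > 0` iff `M > 0` in every orthonormal frame** (four-dimensional Riemannian manifold,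
Levi-Civita connection of a `C^n` metric, `n ≥ 2`). [cite: Hamilton1986, §1, p. 153; §7, p. 170] -/
theorem hasPositiveCurvatureOperatorWith_iff_quad_blocks_pos (hE : finrank ℝ E = 4)
    (hg : g.IsRiemannian) (hLC : g.IsLeviCivita cov) (hn : 2 ≤ n) :
    g.HasPositiveCurvatureOperatorWith cov ↔
      ∀ (x : M) (e : Fin 4 → TangentSpace I x), g.IsOrthonormalFrame x e →
        ∀ v : (Fin 3 → ℝ) × (Fin 3 → ℝ), v ≠ 0 →
          0 < quad (g.blockA cov x e, g.blockB cov x e, g.blockC cov x e) v := by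
  haveI : CompleteSpace E := FiniteDimensional.complete ℝ E
  exact ⟨fun hR x e he v hv ↦ hR.quad_blocks_pos hLC hn x he hv,
    hasPositiveCurvatureOperatorWith_of_quad_blocks_pos hE hg hLC hn⟩

/-! ### Metric-level versions: all Levi-Civita connections at once -/

section Metric

variable [CompleteSpace E]

/-- **`g` has positive curvature operator iff `M > 0` in every orthonormal frame for ONE
Levi-Civita connection** (four-dimensional Riemannian manifold, `C^n` metric, `n ≥ 2`): the
`∀ cov`-quantified `HasPositiveCurvatureOperator` tested on the blocks of a single torsion-free
`g`-compatible `cov` (all Levi-Civita connections have the same `Rm(φ, φ)`,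
`IsLeviCivita.curvatureOperatorForm_eq_of_isLeviCivita`). This is the shape in which Hamilton
1986, §9, case 6 ("Here `M_{αβ} > 0` so the manifold is `S⁴` or `RP⁴` by our previous result")
hands the evolved metric to Thm. 1.1 (`hamilton_positiveCurvatureOperator_classification_four`).
[cite: Hamilton1986, §1, p. 153; §9, case 6 (p. 179)] -/
theorem hasPositiveCurvatureOperator_iff_quad_blocks_pos (hE : finrank ℝ E = 4)
    (hg : g.IsRiemannian) (hLC : g.IsLeviCivita cov) (hn : 2 ≤ n) :
    g.HasPositiveCurvatureOperator ↔
      ∀ (x : M) (e : Fin 4 → TangentSpace I x), g.IsOrthonormalFrame x e →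
        ∀ v : (Fin 3 → ℝ) × (Fin 3 → ℝ), v ≠ 0 →
          0 < quad (g.blockA cov x e, g.blockB cov x e, g.blockC cov x e) v := by
  rw [← hasPositiveCurvatureOperatorWith_iff_quad_blocks_pos hE hg hLC hn]
  refine ⟨fun h ↦ h cov hLC, fun h cov' hLC' x m X Y hXY ↦ ?_⟩
  rw [hLC'.curvatureOperatorForm_eq_of_isLeviCivita hLC hn x X Y]
  exact h x m X Y hXY

/-- **`g` has non-negative curvature operator iff `M ≥ 0` in every orthonormal frame for ONE
Levi-Civita connection** (four-dimensional Riemannian manifold, `C^n` metric, `n ≥ 2`) — the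
hypothesis of Hamilton 1986, Thm. 1.3 (`hamilton_nonnegCurvatureOperator_classification_four`)
in the block language of its proof (§§8–9). [cite: Hamilton1986, §1, p. 153; §8, Lemma 8.2 (p. 174)] -/
theorem hasNonnegCurvatureOperator_iff_operatorGE_blocks (hE : finrank ℝ E = 4)
    (hg : g.IsRiemannian) (hLC : g.IsLeviCivita cov) (hn : 2 ≤ n) :
    g.HasNonnegCurvatureOperator ↔
      ∀ (x : M) (e : Fin 4 → TangentSpace I x), g.IsOrthonormalFrame x e →
        OperatorGE (g.blockA cov x e, g.blockB cov x e, g.blockC cov x e) 0 := by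
  rw [← hasNonnegCurvatureOperatorWith_iff_operatorGE_blocks hE hg hLC hn]
  refine ⟨fun h ↦ h cov hLC, fun h cov' hLC' x m X Y ↦ ?_⟩
  rw [hLC'.curvatureOperatorForm_eq_of_isLeviCivita hLC hn x X Y]
  exact h x m X Y

end Metric

end Frame

end Literature.Geometry.Riemannian

end
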